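import Literature.NumberTheory.EllipticCurves.BSDSelmer
import Literature.NumberTheory.EllipticCurves.SelmerCorankProofs
import Literature.NumberTheory.EllipticCurves.PadicPointsFiniteIndexProofs
import Literature.NumberTheory.EllipticCurves.MordellWeilTheoremProofs
import Literature.NumberTheory.EllipticCurves.PointDivisibilityProofs
import HarnessLib

/-!
# Rank one and finite `Ш[p^∞]` force the `p`-strict Selmer group to be finite

Trunk T-NT-EC (`Literature/NumberTheory/EllipticCurves`), companion to `BSDSelmer` (bsd.S25) and
to the `p^∞` Kummer theory of `SelmerCorankProofs`. The main theorem
`finite_strictSelmer_of_mordellWeilRank_eq_one` says: for an elliptic curve `E/ℚ` (any model `W`)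
and a prime `p`, if `rank_ℤ E(ℚ) = 1` and `Ш(E/ℚ)[p^∞]` is finite then the `p`-strict Selmer group
`Sel_0(ℚ, E[p^∞]) = Sel_{p^∞}(E/ℚ) ∩ ker (H¹(ℚ, E[p^∞]) → H¹(ℚ_p, E[p^∞]))` — in the tree
`W.selmerGroupPInfty p ⊓ selmerLocalKerPrimaryTorsion W ℚ_[p] p`, the hypothesis `hloc` of the
interim bsd.S25 statement `analyticRank_eq_one_of_selmerCorank_eq_one` — is finite. This is the
step "Assumption (res) holds if we further assume `#Ш(E/ℚ)[p^∞] < ∞`" of C.-H. Kim, Math. Ann. 387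
(2022), §1 (deduction of Cor. 1.4 from Cor. 1.2, with Prop. 2.10), printed as a lemma (in the
language of the Bloch–Kato Selmer group of `V_p E`) by C. Skinner, Ann. of Math. 191 (2020), §2.2,
Lemma `rank1lemma`: "If `rank_ℤ A_f(K) = [M_f:ℚ]` and `#Ш(A_f/K)[p^∞] < ∞`, then
`dim_L H¹_f(K, V) = 1` and the restriction map `H¹_f(K, V) → H¹(K_𝔩, V)` is an injection for each
`𝔩 ∣ p`" (used over `ℚ` in §3: "by the obvious analog of Lemma `rank1lemma` with `K` replaced by
`ℚ`"). Everything here is PROVED; no named fact is introduced.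

## The argument (elementary; Greenberg 1999, §2, pp. 62–63 for the Kummer theory)

Write `κ : E(ℚ) ⊗ ℚ_p/ℤ_p ↪ H¹(ℚ, E[p^∞])` for the `p^∞` Kummer map (`kummerMapPInfty`, injective
with image `ker (H¹(ℚ, E[p^∞]) → H¹(ℚ, E))`, `range_kummerMapPInfty`) and
`κ_N : E(ℚ) → H¹(ℚ, E[p^∞])`
for its level-`N` piece (`kummerMapLevel`, `P ↦ [σ ↦ σQ - Q]`, `p^N Q = P`). Since
`Sel_{p^∞}(E/ℚ) ↠ Ш(E/ℚ)[p^∞]` with kernel `im κ` (`map_primaryH1ToH1_selmerGroupPInfty`) and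
`Ш[p^∞]` is finite, it suffices that `Sel_0 ∩ im κ` be finite (§4 below: finite kernel and finite
image of `Sel_0 → H¹(ℚ, E)`). An element of `im κ` is `κ_N(P)` (`exists_eq_tmul_prufGen`). If
`κ_N(P)` vanishes in `H¹(ℚ_p, E[p^∞])`, the cocycle `τ ↦ τQ - Q` is the coboundary of some
`T ∈ E(ℚ̄_p)[p^∞]`, so `Q - T ∈ E(ℚ̄_p)^{Γ_{ℚ_p}} = E(ℚ_p)` (Galois descent over `ℚ_p`,
`exists_map_eq_of_forall_smul_localPoints_eq`), whence `P ∈ p^N E(ℚ_p) + E(ℚ_p)_{tors}`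
(`exists_eq_nsmul_add_of_res_kummerMapLevel_eq_zero`). Now `E(ℚ_p)` has a finite-index subgroup
`≅ ℤ_p` (Silverman, AEC, Prop. VII.6.3; tree theorem `exists_finiteIndex_addEquiv_padicInt_holds`),
which yields `λ : E(ℚ_p) → ℤ_p` with kernel exactly the torsion
(`exists_addMonoidHom_padicInt_apply_eq_zero_iff`); and `E(ℚ) = ℤ P₁ + E(ℚ)_{tors}` by Mordell–Weil
and `rank_ℤ E(ℚ) = 1` (`exists_generator_of_mordellWeilRank_eq_one`, from the tree's
`exists_isMordellWeilBasis_holds`). Writing `P = a P₁ + t`, the condition gives `p^N ∣ a λ(P₁)` in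
`ℤ_p`, so `p^{N - v} ∣ a` with `v = v_p(λ(P₁)) < ∞` (`P₁` has infinite order in `E(ℚ_p)`), hence
`κ_N(P) = κ_v(a' P₁)` (`kummerMapLevel_level`; torsion points have trivial Kummer classes,
`kummerMapLevel_eq_zero_of_isOfFinAddOrder`): `Sel_0 ∩ im κ ⊆ ⋃_{m ≤ v} im κ_m`, a finite set
(`finite_range_kummerMapLevel`: `κ_m` kills `p^m E(ℚ)` and `E(ℚ)` is finitely generated).

The theorem is proved for any number field `K` and any `K`-field `E` (perfect) carrying such a
`λ : E(E) → ℤ_p` (`finite_strictSelmer_of_mordellWeilRank_eq_one_of_hom`), then specialised to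
`K = ℚ`, `E = ℚ_p`.

## Design notes

* Only theorems (no definitions, no named facts). Inputs from the tree, all proved there:
  `zsmul_geomPoints_surjective_holds` (divisibility of `E(K̄)`), `module_finite_point_holds` and
  `exists_isMordellWeilBasis_holds` (Mordell–Weil), `exists_finiteIndex_addEquiv_padicInt_holds`
  (AEC VII.6.3), the `p^∞` Kummer theory of `SelmerCorankProofs`.
* Over a general field `K` the group `E(K) = W.toAffine.Point` and the source `(W⁄K).Point` of
  Mathlib's `Affine.Point.baseChange K E` agree only up to unfolding, so the base change to `E` is
  used through a `let`-bound homomorphism with source `W.toAffine.Point` (as `toGeomPoints` does in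
  `SelmerCorankProofs`); likewise `localPoints W E` versus `(W⁄Ē).Point` (a `change` to the
  `localPoints`-typed expression before the final rewrites).
* What is NOT here: the converse (finite `Sel_0` and corank one give back (res)), and any
  statement about the Bloch–Kato Selmer group of `V_p E` (not in the tree).

## References

* [Skinner2020] C. Skinner, *A converse to a theorem of Gross, Zagier, and Kolyvagin*, Ann. of
  Math. 191 (2020), 329–354 = arXiv:1405.7294, §2.2 (Lemma `rank1lemma` and the paragraph before
  it), §3. Held text `paper:arxiv-1405.7294` (chunks 7, 15); PRINT pages (Annals, text
  `paper:url-0fde7123394a`): §2.2 Lemma 2.2.2 (= v1 «Lemma 2», rank1lemma) p. 338, §3 pp. 350–351 —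
  statements identical in both editions (ARM P D-AUDIT-r06, sheet 419e973b70199756, Table E,
  2026-08-26).
* [Kim2022] C.-H. Kim, Math. Ann. 387 (2022), 1961–1968 = arXiv:2109.12344, §1 (sentence
  preceding Cor. 1.4), Prop. 2.10.
* [Greenberg1999LNM] R. Greenberg, *Iwasawa theory for elliptic curves*, LNM 1716 (1999), §2,
  pp. 62–63 (Kummer theory).
* [SilvermanAEC2009] J. H. Silverman, *The Arithmetic of Elliptic Curves*, 2nd ed. (2009),
  Prop. VII.6.3, VIII.§1–2, Thm. VIII.6.7.
-/

noncomputable section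

open scoped Classical
open scoped TensorProduct

open WeierstrassCurve

universe u

namespace Literature.NumberTheory.EllipticCurves

/-! ### 1. Algebraic inputs: `E(ℚ_p) → ℤ_p`, valuations, the rank-one Mordell–Weil group -/

/-- **A homomorphism `λ : E(ℚ_p) → ℤ_p` whose kernel is exactly the torsion subgroup.** For an
elliptic curve `V/ℚ_p`, `E(ℚ_p)` has a subgroup `A` of finite index `m` with `A ≅ ℤ_p` (Silverman,
AEC, Prop. VII.6.3; tree theorem `exists_finiteIndex_addEquiv_padicInt_holds`); then
`λ(X) = e(mX)` (`e : A ≅ ℤ_p`) is additive, and `λ(X) = 0 ↔ mX = 0 ↔ X` has finite order (`ℤ_p`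
being torsion-free). [cite: SilvermanAEC2009, Prop. VII.6.3] -/
theorem exists_addMonoidHom_padicInt_apply_eq_zero_iff (p : ℕ) [Fact p.Prime]
    (V : WeierstrassCurve ℚ_[p]) [V.IsElliptic] :
    ∃ lam : V.toAffine.Point →+ ℤ_[p], ∀ X, lam X = 0 ↔ IsOfFinAddOrder X := by
  obtain ⟨A, hA, ⟨e⟩⟩ := exists_finiteIndex_addEquiv_padicInt_holds p V
  haveI := hA
  have hidx : A.index ≠ 0 := AddSubgroup.FiniteIndex.index_ne_zero
  let mulIdx : V.toAffine.Point →+ A :=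
    AddMonoidHom.mk' (fun X => ⟨A.index • X, A.nsmul_index_mem X⟩) fun X Y =>
      Subtype.ext (smul_add (A.index) X Y)
  refine ⟨e.toAddMonoidHom.comp mulIdx, fun X => ?_⟩
  constructor
  · intro h
    have h1 : mulIdx X = 0 := by
      have : e (mulIdx X) = 0 := h
      exact e.injective (this.trans (map_zero e).symm)
    have h2 : A.index • X = 0 := congrArg Subtype.val h1
    exact isOfFinAddOrder_iff_nsmul_eq_zero.mpr ⟨A.index, Nat.pos_of_ne_zero hidx, h2⟩
  · intro h
    obtain ⟨n, hn, hnX⟩ := isOfFinAddOrder_iff_nsmul_eq_zero.mp h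
    have h3 : n • (e.toAddMonoidHom.comp mulIdx) X = 0 := by
      rw [← map_nsmul, hnX, map_zero]
    exact (smul_eq_zero.mp h3).resolve_left hn.ne'

/-- Valuation bookkeeping in `ℤ_p`: if `p^N ∣ a u` with `u ≠ 0` then `p^{N - v_p(u)} ∣ a` (in `ℤ`),
by `u = (unit) · p^{v_p(u)}` (Mathlib `PadicInt.unitCoeff_spec`) and `PadicInt.pow_p_dvd_int_iff`.
[folklore] -/
theorem pow_sub_valuation_dvd_of_pow_dvd_mul (p : ℕ) [Fact p.Prime] {u : ℤ_[p]} (hu : u ≠ 0)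
    {a : ℤ} {N : ℕ} (h : (p : ℤ_[p]) ^ N ∣ (a : ℤ_[p]) * u) :
    (p : ℤ) ^ (N - u.valuation) ∣ a := by
  rw [← PadicInt.pow_p_dvd_int_iff]
  rcases le_or_gt N u.valuation with hle | hlt
  · rw [Nat.sub_eq_zero_of_le hle, pow_zero]
    exact one_dvd _
  · have hp0 : (p : ℤ_[p]) ≠ 0 := Nat.cast_ne_zero.mpr (Fact.out : p.Prime).ne_zero
    have hsplit : (p : ℤ_[p]) ^ N =
        (p : ℤ_[p]) ^ (N - u.valuation) * (p : ℤ_[p]) ^ u.valuation := by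
      rw [← pow_add, Nat.sub_add_cancel hlt.le]
    rw [PadicInt.unitCoeff_spec hu, hsplit, ← mul_assoc] at h
    have h' : (p : ℤ_[p]) ^ (N - u.valuation) ∣ (a : ℤ_[p]) * (PadicInt.unitCoeff hu : ℤ_[p]) :=
      (mul_dvd_mul_iff_right (pow_ne_zero _ hp0)).mp h
    exact (Units.isUnit (PadicInt.unitCoeff hu)).dvd_mul_right.mp h'

/-- **Rank one: `E(K) = ℤ P₁ + E(K)_{tors}` with `P₁` of infinite order.** For an elliptic curve
over a number field with `rank_ℤ E(K) = 1`, the unique element `P₁` of a Mordell–Weil basis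
(`exists_isMordellWeilBasis_holds`, Mordell–Weil, Silverman AEC VIII.6) has infinite order and
every point is `a P₁ + t` with `t` torsion (its class spans `E(K)/E(K)_{tors}`).
[cite: SilvermanAEC2009, Thm. VIII.6.7 and §VIII.6] -/
theorem exists_generator_of_mordellWeilRank_eq_one {K : Type*} [Field K] [NumberField K]
    (W : WeierstrassCurve K) [W.IsElliptic] (h : W.mordellWeilRank = 1) :
    ∃ P₁ : W.toAffine.Point, ¬ IsOfFinAddOrder P₁ ∧
      ∀ P : W.toAffine.Point, ∃ (a : ℤ) (t : W.toAffine.Point),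
        IsOfFinAddOrder t ∧ P = a • P₁ + t := by
  obtain ⟨b, hb⟩ := W.exists_isMordellWeilBasis_holds
  let i : Fin W.mordellWeilRank := ⟨0, by omega⟩
  have hi : ∀ j : Fin W.mordellWeilRank, j = i := fun j => Fin.ext (by have := j.2; omega)
  refine ⟨b i, fun htor => ?_, fun P => ?_⟩
  · apply hb.1.ne_zero i
    simp only [Function.comp_apply]
    exact (QuotientAddGroup.eq_zero_iff _).mpr htor
  · have hmem : (QuotientAddGroup.mk P : mordellWeilModTorsion W) ∈
        Submodule.span ℤ (Set.range (QuotientAddGroup.mk ∘ b : _ → mordellWeilModTorsion W)) := by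
      rw [hb.2]; exact Submodule.mem_top
    have hrange : Set.range (QuotientAddGroup.mk ∘ b : _ → mordellWeilModTorsion W) =
        {((QuotientAddGroup.mk ∘ b) i : mordellWeilModTorsion W)} := by
      ext x
      simp only [Set.mem_range, Set.mem_singleton_iff]
      constructor
      · rintro ⟨j, rfl⟩; rw [hi j]
      · rintro rfl; exact ⟨i, rfl⟩
    rw [hrange, Submodule.mem_span_singleton] at hmem
    obtain ⟨a, ha⟩ := hmem
    refine ⟨a, P - a • b i, ?_, by abel⟩
    have h0 : (QuotientAddGroup.mk (P - a • b i) : mordellWeilModTorsion W) = 0 := by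
      rw [QuotientAddGroup.mk_sub, QuotientAddGroup.mk_zsmul, ← ha, sub_eq_zero]
      rfl
    exact (QuotientAddGroup.eq_zero_iff _).mp h0

/-! ### 2. Kummer classes: torsion points, finiteness of `im κ_m` -/

/-- **Torsion points have trivial `p^∞` Kummer classes**: `κ_N(t) = κ(t ⊗ e_N) = 0` for `t` of
finite order `n`, since `t ⊗ e_N = t ⊗ n y = n t ⊗ y = 0` in `E(K) ⊗ ℚ_p/ℤ_p` (`ℚ_p/ℤ_p` is
divisible, `PruferQuot.divisible`). Greenberg 1999, §2, p. 62 (`E(M) ⊗ ℚ_p/ℤ_p`). [folklore] -/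
theorem kummerMapLevel_eq_zero_of_isOfFinAddOrder {K : Type*} [Field K] (W : WeierstrassCurve K)
    (p : ℕ) [Fact p.Prime] (hdiv : W.zsmul_geomPoints_surjective) [W.IsElliptic] (N : ℕ)
    {t : W.toAffine.Point} (ht : IsOfFinAddOrder t) : kummerMapLevel W p hdiv N t = 0 := by
  obtain ⟨n, hn, hnt⟩ := isOfFinAddOrder_iff_nsmul_eq_zero.mp ht
  obtain ⟨y, hy⟩ := PruferQuot.divisible p (Int.natCast_ne_zero.mpr hn.ne') (prufGen p N)
  rw [← kummerMapPInfty_tmul_prufGen, ← hy, ← TensorProduct.smul_tmul, natCast_zsmul, hnt,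
    TensorProduct.zero_tmul, map_zero]

/-- **The level-`m` Kummer map has finite image**: `im κ_m` is a finitely generated abelian group
(image of `E(K)`, Mordell–Weil `module_finite_point_holds`) killed by `p^m`
(`kummerMapLevel_nsmul_self`), hence finite (Mathlib `AddCommGroup.finite_of_fg_torsion`); this is
the finiteness of `E(K)/p^m E(K)`. Silverman, AEC, VIII.§1–2.
[cite: SilvermanAEC2009, Thm. VIII.6.7] -/
theorem finite_range_kummerMapLevel {K : Type*} [Field K] [NumberField K] (W : WeierstrassCurve K)
    (p : ℕ) [Fact p.Prime] (hdiv : W.zsmul_geomPoints_surjective) [W.IsElliptic] (m : ℕ) :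
    Finite (kummerMapLevel W p hdiv m).range := by
  haveI : Module.Finite ℤ W.toAffine.Point := by convert W.module_finite_point_holds
  haveI : AddGroup.FG W.toAffine.Point := Module.Finite.iff_addGroup_fg.mp inferInstance
  refine AddCommGroup.finite_of_fg_torsion (kummerMapLevel W p hdiv m).range fun x => ?_
  obtain ⟨P, hP⟩ := x.2
  refine isOfFinAddOrder_iff_nsmul_eq_zero.mpr ⟨p ^ m, pow_pos (Fact.out : p.Prime).pos m, ?_⟩
  apply Subtype.ext
  rw [AddSubgroupClass.coe_nsmul, ← hP, ← map_nsmul, kummerMapLevel_nsmul_self,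
    ZeroMemClass.coe_zero]

/-! ### 3. The local computation at a `K`-field `E` -/

/-- **Galois descent for `localPoints`**: a point of `E(Ē)` (`localPoints W E`, `E` a perfect
`K`-field, `Γ_E` acting through `restrictScalarsHom`) fixed by `Γ_E` comes from `E(E)` under
`E → Ē`: its coordinates are fixed by `Gal(Ē/E)`, hence lie in `E` (Mathlib
`InfiniteGalois.mem_range_algebraMap_iff_fixed`), and nonsingularity descends along the injection
`E → Ē` (`Affine.baseChange_nonsingular`). The case `E = K` is the tree's
`fixedPoints_eq_range_map_holds`. Silverman, AEC, I.§1 and VIII.§1.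
[cite: SilvermanAEC2009, I.§1 and VIII.§1] -/
theorem exists_map_eq_of_forall_smul_localPoints_eq {K : Type u} [Field K]
    (W : WeierstrassCurve K) (E : Type u) [Field E] [Algebra K E] [PerfectField E]
    {X : localPoints W E} (hX : ∀ τ : Field.absoluteGaloisGroup E, τ • X = X) :
    ∃ R : (W.baseChange E).toAffine.Point,
      Affine.Point.map (IsScalarTower.toAlgHom K E (AlgebraicClosure E)) R = X := by
  haveI : IsGalois E (AlgebraicClosure E) := {}
  change (W.baseChange (AlgebraicClosure E)).toAffine.Point at X
  rcases X with _ | ⟨x, y, h⟩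
  · exact ⟨0, rfl⟩
  · have hxy : ∀ σ : AlgebraicClosure E ≃ₐ[E] AlgebraicClosure E, σ x = x ∧ σ y = y := fun σ => by
      have h' := hX σ
      rw [localPoints.smul_def] at h'
      change Affine.Point.map _ (Affine.Point.some x y h) = Affine.Point.some x y h at h'
      rw [Affine.Point.map_some] at h'
      exact ⟨(Affine.Point.some.inj h').1, (Affine.Point.some.inj h').2⟩
    obtain ⟨x₀, rfl⟩ := (InfiniteGalois.mem_range_algebraMap_iff_fixed x).mpr fun σ => (hxy σ).1
    obtain ⟨y₀, rfl⟩ := (InfiniteGalois.mem_range_algebraMap_iff_fixed y).mpr fun σ => (hxy σ).2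
    have h₀ : (W.baseChange E).toAffine.Nonsingular x₀ y₀ :=
      (Affine.baseChange_nonsingular W (f := IsScalarTower.toAlgHom K E (AlgebraicClosure E))
        (algebraMap E (AlgebraicClosure E)).injective x₀ y₀).mp h
    exact ⟨Affine.Point.some x₀ y₀ h₀, rfl⟩

/-- **Local triviality of a Kummer class forces divisibility up to torsion.** Let `P ∈ E(K)`,
`p^N Q = P` in `E(K̄)`, and suppose the level-`N` Kummer class `κ_N(P) = [σ ↦ σQ - Q]` restricts
to `0` in `H¹(E, E(Ē)[p^∞])` (the local restriction along the chosen embedding `K̄ → Ē`,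
`resH1Hom (resGal E) (primaryPointsMap W E p)`, whose kernel is `selmerLocalKerPrimaryTorsion`).
Then `P = p^N R + T` in `E(E)` with `T` of finite order: the restricted cocycle `τ ↦ τ ιQ - ιQ`
(`map_oneCocycleClass`, `pointsMap_smul`) is a coboundary `τ ↦ τv - v` of some
`v ∈ E(Ē)[p^∞]` (`oneCocycleClass_eq_zero_iff`), so `ιQ - v` is `Γ_E`-fixed and equals the image
of some `R ∈ E(E)` (`exists_map_eq_of_forall_smul_localPoints_eq`); multiplying by `p^N` and
comparing with `ιP` (`Affine.Point.map_baseChange`), `P - p^N R` maps to `p^N v`, a torsion point,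
and `E(E) → E(Ē)` is injective. Silverman, AEC, VIII.§2 (Kummer pairing) and X.§4 (local
conditions); Greenberg 1999, §2, pp. 62–63. [folklore] -/
theorem exists_eq_nsmul_add_of_res_kummerMapLevel_eq_zero {K : Type u} [Field K]
    (W : WeierstrassCurve K) (p : ℕ) [Fact p.Prime] (hdiv : W.zsmul_geomPoints_surjective)
    [W.IsElliptic] (E : Type u) [Field E] [Algebra K E] [PerfectField E] (N : ℕ)
    (P : W.toAffine.Point)
    (h : resH1Hom (resGal (K := K) E) (primaryPointsMap W E p) (primaryPointsMap_smul W E p)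
      (kummerMapLevel W p hdiv N P) = 0) :
    ∃ R T : (W.baseChange E).toAffine.Point, IsOfFinAddOrder T ∧
      Affine.Point.baseChange (W' := W) K E P = p ^ N • R + T := by
  have hQ : p ^ N • kummerRoot W p hdiv N P = toGeomPoints W P := nsmul_kummerRoot W p hdiv N P
  set Q := kummerRoot W p hdiv N P with hQdef
  have h' := (GaloisRepresentations.map_oneCocycleClass _ (resGal (K := K) E)
    (resHomOfEquivariant (resGal (K := K) E) (primaryPointsMap W E p) (primaryPointsMap_smul W E p))
    (kummerCocycle W p N Q (smul_nsmul_of_nsmul_eq W p hQ))).symm.trans h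
  rw [GaloisRepresentations.oneCocycleClass_eq_zero_iff] at h'
  obtain ⟨v, hv⟩ := h'
  have hv' : ∀ τ : Field.absoluteGaloisGroup E,
      pointsMap W E (resGal (K := K) E τ • Q - Q) = τ • (v : localPoints W E) - v := fun τ =>
    congrArg Subtype.val (hv τ)
  have hfix : ∀ τ : Field.absoluteGaloisGroup E,
      τ • (pointsMap W E Q - (v : localPoints W E)) = pointsMap W E Q - v := fun τ => by
    have h1 := hv' τ
    rw [map_sub, pointsMap_smul] at h1
    rw [smul_sub]
    exact sub_eq_sub_iff_sub_eq_sub.mp h1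
  obtain ⟨R, hR⟩ := exists_map_eq_of_forall_smul_localPoints_eq W E hfix
  have hjP : (Affine.Point.map (W' := W) (IsScalarTower.toAlgHom K E (AlgebraicClosure E))
      (Affine.Point.baseChange (W' := W) K E P) : localPoints W E) =
        pointsMap W E (toGeomPoints W P) := by
    change Affine.Point.map _ (Affine.Point.baseChange (W' := W) K E P) =
      Affine.Point.map (closureEmb (K := K) E)
        (Affine.Point.baseChange (W' := W) K (AlgebraicClosure K) P)
    rw [Affine.Point.map_baseChange, Affine.Point.map_baseChange]
  obtain ⟨k, hk⟩ := (AddCommGroup.mem_primaryComponent).mp v.2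
  refine ⟨R, Affine.Point.baseChange (W' := W) K E P - p ^ N • R, ?_, by abel⟩
  refine isOfFinAddOrder_iff_nsmul_eq_zero.mpr ⟨p ^ k, pow_pos (Fact.out : p.Prime).pos k, ?_⟩
  apply Affine.Point.map_injective (W' := W) (IsScalarTower.toAlgHom K E (AlgebraicClosure E))
  rw [map_nsmul, map_zero, map_sub, map_nsmul]
  change p ^ k • ((Affine.Point.map (W' := W) (IsScalarTower.toAlgHom K E (AlgebraicClosure E))
      (Affine.Point.baseChange (W' := W) K E P) : localPoints W E) -
      p ^ N • (Affine.Point.map (W' := W) (IsScalarTower.toAlgHom K E (AlgebraicClosure E)) R :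
        localPoints W E)) = 0
  rw [hjP, hR, ← hQ, map_nsmul]
  change p ^ k • (p ^ N • pointsMap W E Q - p ^ N • (pointsMap W E Q - (v : localPoints W E))) =
    (0 : localPoints W E)
  rw [← smul_sub, sub_sub_cancel, ← mul_smul, mul_comm, mul_smul, hk, smul_zero]

/-- **Bounded level.** With `λ : E(E) → ℤ_p` vanishing exactly on torsion and `rank_ℤ E(K) = 1`
(`E(K) = ℤ P₁ + E(K)_{tors}`), there is `N₀` (namely `v_p(λ(P₁))`, finite since `P₁` has infinite
order in `E(E)`) such that every locally trivial `κ_N(P)` is a `κ_m(P')` with `m ≤ N₀`: by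
`exists_eq_nsmul_add_of_res_kummerMapLevel_eq_zero`, `P = p^N R + T` in `E(E)`; writing
`P = a P₁ + t` and applying `λ` gives `p^N ∣ a λ(P₁)`, so `p^{N - N₀} ∣ a`
(`pow_sub_valuation_dvd_of_pow_dvd_mul`) and `κ_N(P) = κ_N(p^{N-N₀} a' P₁) + κ_N(t) = κ_{N₀}(a' P₁)`
(`kummerMapLevel_level`, `kummerMapLevel_eq_zero_of_isOfFinAddOrder`).
[cite: Skinner2020, §2.2 (Lemma rank1lemma) and §3] -/
theorem exists_level_le_of_res_kummerMapLevel_eq_zero {K : Type u} [Field K] [NumberField K]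
    (W : WeierstrassCurve K) [W.IsElliptic] (p : ℕ) [Fact p.Prime]
    (hdiv : W.zsmul_geomPoints_surjective) (E : Type u) [Field E] [Algebra K E] [PerfectField E]
    (lam : (W.baseChange E).toAffine.Point →+ ℤ_[p]) (hlam : ∀ X, lam X = 0 ↔ IsOfFinAddOrder X)
    (hrank : W.mordellWeilRank = 1) :
    ∃ N₀ : ℕ, ∀ (N : ℕ) (P : W.toAffine.Point),
      resH1Hom (resGal (K := K) E) (primaryPointsMap W E p) (primaryPointsMap_smul W E p)
        (kummerMapLevel W p hdiv N P) = 0 →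
      ∃ m ≤ N₀, ∃ P' : W.toAffine.Point,
        kummerMapLevel W p hdiv N P = kummerMapLevel W p hdiv m P' := by
  obtain ⟨P₁, hP₁, hgen⟩ := exists_generator_of_mordellWeilRank_eq_one W hrank
  let bc : W.toAffine.Point →+ (W.baseChange E).toAffine.Point :=
    Affine.Point.baseChange (W' := W) K E
  have hinj : Function.Injective bc := Affine.Point.map_injective (W' := W) (Algebra.ofId K E)
  have htors : ∀ {x : W.toAffine.Point}, IsOfFinAddOrder x → IsOfFinAddOrder (bc x) := fun hx => by
    obtain ⟨n, hn, hnx⟩ := isOfFinAddOrder_iff_nsmul_eq_zero.mp hx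
    exact isOfFinAddOrder_iff_nsmul_eq_zero.mpr ⟨n, hn, by rw [← map_nsmul, hnx, map_zero]⟩
  have hu0 : lam (bc P₁) ≠ 0 := by
    intro h0
    apply hP₁
    obtain ⟨n, hn, hnP⟩ := isOfFinAddOrder_iff_nsmul_eq_zero.mp ((hlam _).mp h0)
    refine isOfFinAddOrder_iff_nsmul_eq_zero.mpr ⟨n, hn, hinj ?_⟩
    rw [map_nsmul, map_zero]
    exact hnP
  refine ⟨(lam (bc P₁)).valuation, fun N P hres => ?_⟩
  obtain ⟨R, T, hT, hPRT⟩ :=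
    exists_eq_nsmul_add_of_res_kummerMapLevel_eq_zero W p hdiv E N P hres
  obtain ⟨a, t, ht, rfl⟩ := hgen P
  have hPRT' : bc (a • P₁ + t) = p ^ N • R + T := hPRT
  have hdvd : (p : ℤ_[p]) ^ N ∣ (a : ℤ_[p]) * lam (bc P₁) := by
    have h1 := congrArg lam hPRT'
    rw [map_add, map_zsmul, map_add, map_add, map_zsmul, map_nsmul, (hlam _).mpr (htors ht),
      (hlam T).mpr hT, add_zero, add_zero] at h1
    refine ⟨lam R, ?_⟩
    rw [← zsmul_eq_mul, h1, nsmul_eq_mul, Nat.cast_pow]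
  obtain ⟨a', ha'⟩ := pow_sub_valuation_dvd_of_pow_dvd_mul p hu0 hdvd
  rcases le_or_gt N (lam (bc P₁)).valuation with hle | hlt
  · exact ⟨N, hle, a • P₁ + t, rfl⟩
  · refine ⟨(lam (bc P₁)).valuation, le_rfl, a' • P₁, ?_⟩
    have ha'' : a = ((p ^ (N - (lam (bc P₁)).valuation) : ℕ) : ℤ) * a' := by
      rw [ha']; push_cast; ring
    have ht0 : kummerMapLevel W p hdiv N t = 0 :=
      kummerMapLevel_eq_zero_of_isOfFinAddOrder W p hdiv N ht
    rw [map_add, ht0, add_zero, ha'', ← smul_smul, natCast_zsmul]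
    exact kummerMapLevel_level W p hdiv (lam (bc P₁)).valuation (N - (lam (bc P₁)).valuation) N
      (by omega) (a' • P₁)

/-! ### 4. The finiteness theorem -/

/-- **Rank one and finite `Ш[p^∞]` force the `p`-strict Selmer group to be finite — general form.**
For an elliptic curve `E` over a number field `K`, a prime `p`, and a perfect `K`-field `E` such
that `E(E)` admits `λ : E(E) → ℤ_p` vanishing exactly on the torsion: if `rank_ℤ E(K) = 1` and
`Ш(E/K)[p^∞]` is finite, then `Sel_{p^∞}(E/K) ∩ ker (H¹(K, E[p^∞]) → H¹(E, E(Ē)[p^∞]))` is finite.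
Proof: for `S₀` this intersection, the map `S₀ → H¹(K, E)` has image inside the image of
`Sel_{p^∞}`, which is `Ш[p^∞]` (`map_primaryH1ToH1_selmerGroupPInfty`), finite; its kernel lies in
`im κ` (`range_kummerMapPInfty`), i.e. consists of classes `κ_N(P)` (`exists_eq_tmul_prufGen`,
`kummerMapPInfty_tmul_prufGen`) that are locally trivial, hence of level `≤ N₀`
(`exists_level_le_of_res_kummerMapLevel_eq_zero`), a finite set (`finite_range_kummerMapLevel`);
finite kernel and finite image give finite `S₀`. Kim, Math. Ann. 387 (2022), §1 with Prop. 2.10;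
Skinner, Ann. of Math. 191 (2020), §2.2, Lemma `rank1lemma` (in `V`-form) and §3.
[cite: Skinner2020, §2.2 (Lemma rank1lemma and the preceding paragraph) and §3] -/
theorem finite_strictSelmer_of_mordellWeilRank_eq_one_of_hom {K : Type u} [Field K] [NumberField K]
    (W : WeierstrassCurve K) [W.IsElliptic] (p : ℕ) [Fact p.Prime]
    (E : Type u) [Field E] [Algebra K E] [PerfectField E]
    (lam : (W.baseChange E).toAffine.Point →+ ℤ_[p]) (hlam : ∀ X, lam X = 0 ↔ IsOfFinAddOrder X)
    (hrank : W.mordellWeilRank = 1) [Finite (AddCommGroup.primaryComponent W.sha p)] :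
    Finite ↥(W.selmerGroupPInfty p ⊓ selmerLocalKerPrimaryTorsion W E p) := by
  have hdiv : W.zsmul_geomPoints_surjective := W.zsmul_geomPoints_surjective_holds
  obtain ⟨N₀, hN₀⟩ := exists_level_le_of_res_kummerMapLevel_eq_zero W p hdiv E lam hlam hrank
  set S₀ := W.selmerGroupPInfty p ⊓ selmerLocalKerPrimaryTorsion W E p with hS₀
  set πS : S₀ →+ W.galH1 := (primaryH1ToH1 W p).comp S₀.subtype with hπS
  -- (i) the image of `S₀` in `H¹(K, E)` lies in `Ш[p^∞]`, finite
  haveI hrange : Finite πS.range := by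
    have hsub : (πS.range : Set W.galH1) ⊆
        ((AddCommGroup.primaryComponent W.sha p).map W.sha.subtype : Set W.galH1) := by
      rintro _ ⟨c, rfl⟩
      have hmem : primaryH1ToH1 W p c ∈ (W.selmerGroupPInfty p).map (primaryH1ToH1 W p) :=
        ⟨c, c.2.1, rfl⟩
      rw [map_primaryH1ToH1_selmerGroupPInfty W p hdiv] at hmem
      exact hmem
    have hfin :
        ((AddCommGroup.primaryComponent W.sha p).map W.sha.subtype : Set W.galH1).Finite := by
      rw [AddSubgroup.coe_map]
      exact (Set.toFinite _).image _
    exact (hfin.subset hsub).to_subtype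
  -- (ii) the kernel consists of Kummer classes of bounded level, finite
  haveI hker : Finite πS.ker := by
    set F : Set (galH1Primary W p) :=
      {c | ∃ m ≤ N₀, ∃ P' : W.toAffine.Point, c = kummerMapLevel W p hdiv m P'} with hFdef
    have hF : F.Finite := by
      have hFsub : F ⊆ ⋃ m ∈ Finset.range (N₀ + 1),
          ((kummerMapLevel W p hdiv m).range : Set (galH1Primary W p)) := by
        rintro c ⟨m, hm, P', rfl⟩
        exact Set.mem_biUnion (Finset.mem_range.mpr (by omega)) ⟨P', rfl⟩
      refine Set.Finite.subset ?_ hFsub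
      refine Set.Finite.biUnion (Finset.finite_toSet _) fun m _ => ?_
      haveI := finite_range_kummerMapLevel W p hdiv m
      exact Set.toFinite _
    have hsub : (πS.ker : Set S₀) ⊆ (fun c : S₀ => (c : galH1Primary W p)) ⁻¹' F := by
      intro c hc
      have hc0 : primaryH1ToH1 W p c = 0 := hc
      have hcker : (c : galH1Primary W p) ∈ (kummerMapPInfty W p hdiv).range := by
        rw [range_kummerMapPInfty W p hdiv]
        exact hc0
      obtain ⟨t, ht⟩ := hcker
      obtain ⟨P, N, rfl⟩ := exists_eq_tmul_prufGen W p t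
      rw [kummerMapPInfty_tmul_prufGen] at ht
      have hres : resH1Hom (resGal (K := K) E) (primaryPointsMap W E p)
          (primaryPointsMap_smul W E p) (kummerMapLevel W p hdiv N P) = 0 := by
        have h2 : (c : galH1Primary W p) ∈ selmerLocalKerPrimaryTorsion W E p := c.2.2
        rw [← ht] at h2
        exact h2
      obtain ⟨m, hm, P', hP'⟩ := hN₀ N P hres
      refine ⟨m, hm, P', ?_⟩
      change (c : galH1Primary W p) = _
      rw [← ht, hP']
    exact ((hF.preimage Subtype.val_injective.injOn).subset hsub).to_subtype
  -- (iii) conclusion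
  haveI : Finite (S₀ ⧸ πS.ker) :=
    Finite.of_equiv _ (QuotientAddGroup.quotientKerEquivRange πS).symm.toEquiv
  apply Nat.finite_of_card_ne_zero
  rw [AddSubgroup.card_eq_card_quotient_mul_card_addSubgroup πS.ker]
  exact mul_ne_zero Nat.card_pos.ne' Nat.card_pos.ne'

/-- **Rank one and finite `Ш(E/ℚ)[p^∞]` force `Sel_0(ℚ, E[p^∞])` to be finite.** For an elliptic
curve `E/ℚ` (any model `W`) and a prime `p`: if `rank_ℤ E(ℚ) = 1` and `Ш(E/ℚ)[p^∞]` is finite then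
the `p`-strict Selmer group `Sel_{p^∞}(E/ℚ) ∩ ker (H¹(ℚ, E[p^∞]) → H¹(ℚ_p, E[p^∞]))`
(`W.selmerGroupPInfty p ⊓ selmerLocalKerPrimaryTorsion W ℚ_[p] p`, the hypothesis `hloc` of
`analyticRank_eq_one_of_selmerCorank_eq_one`) is finite — the general form fed with
`λ : E(ℚ_p) → ℤ_p` from Silverman AEC VII.6.3 (`exists_addMonoidHom_padicInt_apply_eq_zero_iff`).
This is the step "Assumption (res) holds if we further assume `#Ш(E/ℚ)[p^∞] < ∞`" in Kim's
deduction of Cor. 1.4 from Cor. 1.2 (Math. Ann. 387 (2022), §1, with Prop. 2.10), and the `p^∞`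
form over `ℚ` of Skinner's Lemma `rank1lemma` (Ann. of Math. 191 (2020), §2.2, with the preceding
paragraph identifying the maximal divisible subgroup of `Sel_{p^∞}` with the image of `H¹_f(ℚ, V)`;
used over `ℚ` in §3).
[cite: Kim2022, §1 (sentence preceding Cor. 1.4) with Prop. 2.10; Skinner2020, §2.2 (Lemma rank1lemma) and §3] -/
theorem finite_strictSelmer_of_mordellWeilRank_eq_one (W : WeierstrassCurve ℚ) [W.IsElliptic]
    (p : ℕ) [Fact p.Prime] (hrank : W.mordellWeilRank = 1)
    [Finite (AddCommGroup.primaryComponent W.sha p)] :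
    Finite ↥(W.selmerGroupPInfty p ⊓ selmerLocalKerPrimaryTorsion W ℚ_[p] p) := by
  obtain ⟨lam, hlam⟩ := exists_addMonoidHom_padicInt_apply_eq_zero_iff p (W.baseChange ℚ_[p])
  exact finite_strictSelmer_of_mordellWeilRank_eq_one_of_hom W p ℚ_[p] lam hlam hrank

end Literature.NumberTheory.EllipticCurves

end
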